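import Summits.Ventures.QEC.Census.RefinedIPCertificateGrid
import Summits.Ventures.QEC.Census.RefinedIPCertificateSound
import HarnessLib

/-!
# Refined certificates on the evaluation grid: the leaf check, its soundness, and the assembly

Venture QEC (cell `qec`, rung X1; row 06). The GRID variant of the refined branch-and-bound certificates for CRSS's
linear program refined with respect to a codeword [CalderbankEtAl1998, §7 (ii)]: a leaf `RLeafG` carries the
multipliers of the refined MacWilliams identity as a MATRIX `μ_{ij}` over the canonical grid (x-node `i`, y-node
`j`), and the leaf check `rleafOKG` reads the point sums off the tensor-factored tables `gridTab` of
`RefinedIPCertificateGrid.lean` (cost `O(#nodes · #classes)` instead of `O(#points · #classes)`); everything else —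
base rows, marginal/zero/translation/containment/unit families, split path — is exactly as in `rleafOK`
(`RefinedIPCertificate.lean`). Soundness `not_leafHyp_of_rleafOKG` (weak duality; the grid identity
`grid_identity`), trees `RTreeG` with `not_crssRefinedFeasible_of_checkG`, and the assembly
`no_additiveCode_of_certsG` (CRSS's two-stage argument with grid leaves). HONEST FRAMING: nonexistence only; nothing
here certifies a distance; per-cell certificates are DATA files `Census/IPBounds/…`.
[cite: CalderbankEtAl1998, §7 (ii) (printed p. 28)]; [cite: MacWilliamsSloane1977, Ch. 17 §4 Thm. 20].
-/

namespace Summit.Ventures.QEC.Census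

open Finset Literature.InformationTheory.QuantumCodes

/-! ### 1. Grid leaves and their check -/

/-- A **grid leaf**: as `RLeaf`, but the identity multipliers are a matrix `mus` (row `i` = x-node
`(1, i − ⌊m/2⌋)`, column `j` = y-node of `gridY w₀` in order). Column: definition (ours).
[cite: MacWilliamsSloane1977, Ch. 17 §4 Thm. 20] -/
structure RLeafG where
  /-- multipliers of the base rows of the plain system -/
  base : List ℤ
  /-- marginal multipliers `λ_j` (rows `Σ R = A_j`) -/
  lamR : List ℤ
  /-- marginal multipliers `λ'_j` (rows `Σ R' = B_j`) -/
  lamRp : List ℤ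
  /-- identity multipliers `μ_{ij}` on the canonical grid -/
  mus : List (List ℤ)
  /-- zero-row multipliers for `R` -/
  zR : List (List (List ℤ))
  /-- zero-row multipliers for `R'` -/
  zRp : List (List (List ℤ))
  /-- translation-row multipliers for `R` -/
  tR : List (List (List ℤ))
  /-- translation-row multipliers for `R'` -/
  tRp : List (List (List ℤ))
  /-- containment multipliers -/
  kap : List (List (List ℤ))
  /-- multiplier of `R(0,0,0) = 1` -/
  zeta : ℤ
  /-- multiplier of `R(0,w₀,0) = 1` -/
  ups : ℤ
  /-- split multipliers along the path -/
  smult : List ℤ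

/-- A refined certificate with grid leaves. Column: definition (ours). [cite: MacWilliamsSloane1977, Ch. 17 §4 Thm. 20] -/
inductive RTreeG where
  /-- a grid leaf -/
  | leaf (L : RLeafG) : RTreeG
  /-- split on an integer linear form `≤ v ∨ ≥ v + 1` -/
  | split (ca cb cw : List ℤ) (cr crp : List (List (List ℤ))) (v : ℤ) (le ge : RTreeG) : RTreeG

section Check

variable (n k d e w₀ : ℕ)

/-- Combined coefficient of `A_j` (grid leaf). [cite: MacWilliamsSloane1977, Ch. 17 §4 Thm. 20] -/
def coefAG (path : List RSplit) (L : RLeafG) (j : ℕ) : ℤ :=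
  combA (baseRows n k d e) L.base j - L.lamR.getD j 0 + splitCoef path L.smult fun s => s.ca.getD j 0

/-- Combined coefficient of `B_j` (grid leaf). [cite: MacWilliamsSloane1977, Ch. 17 §4 Thm. 20] -/
def coefBG (path : List RSplit) (L : RLeafG) (j : ℕ) : ℤ :=
  combB (baseRows n k d e) L.base j - L.lamRp.getD j 0 + splitCoef path L.smult fun s => s.cb.getD j 0

/-- Combined coefficient of `W_j` (grid leaf). [cite: MacWilliamsSloane1977, Ch. 17 §4 Thm. 20] -/
def coefWG (path : List RSplit) (L : RLeafG) (j : ℕ) : ℤ :=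
  combW (baseRows n k d e) L.base j + splitCoef path L.smult fun s => s.cw.getD j 0

/-- Combined coefficient of `R(a,b,c)` given the table `TT` of `Σ μ · mono(T p; ·)`. [cite: MacWilliamsSloane1977, Ch. 17 §4 Thm. 20] -/
def coefRG (TT : List (List (List ℤ))) (path : List RSplit) (L : RLeafG) (a b c : ℕ) : ℤ :=
  (if b + c ≤ w₀ then L.lamR.getD (a + b + c) 0 - get3 TT a b c + (get3 L.tR a b c - get3 L.tR a (w₀ - b - c) c)
    else 0) +
  (if Odd c ∨ w₀ < b + c then get3 L.zR a b c else 0) - get3 L.kap a b c +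
  (if a = 0 ∧ b = 0 ∧ c = 0 then L.zeta else 0) + (if a = 0 ∧ b = w₀ ∧ c = 0 then L.ups else 0) +
  splitCoef path L.smult fun s => get3 s.cr a b c

/-- Combined coefficient of `R'(a,b,c)` given the table `TP` of `Σ μ · mono(p; ·)`. [cite: MacWilliamsSloane1977, Ch. 17 §4 Thm. 20] -/
def coefRpG (TP : List (List (List ℤ))) (path : List RSplit) (L : RLeafG) (a b c : ℕ) : ℤ :=
  (if b + c ≤ w₀ then L.lamRp.getD (a + b + c) 0 + (2 : ℤ) ^ (n - k) * get3 TP a b c +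
      (get3 L.tRp a b c - get3 L.tRp a (w₀ - b - c) c) else 0) +
  (if Odd c ∨ w₀ < b + c then get3 L.zRp a b c else 0) + get3 L.kap a b c +
  splitCoef path L.smult fun s => get3 s.crp a b c

/-- Combined right-hand side (grid leaf). [cite: MacWilliamsSloane1977, Ch. 17 §4 Thm. 20] -/
def leafRhsG (path : List RSplit) (L : RLeafG) : ℤ :=
  combRhs (baseRows n k d e) L.base + L.zeta + L.ups + splitRhs path L.smult

/-- **The grid leaf check**: the two point tables are computed once (tensor-factored), then the same sign /
nonpositivity / positivity conditions as `rleafOK`. Column: definition (ours). [cite: MacWilliamsSloane1977, Ch. 17 §4 Thm. 20] -/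
def rleafOKG (path : List RSplit) (L : RLeafG) : Bool :=
  let TP := gridTab (n - w₀) w₀ (gridX (n - w₀)) (gridY w₀) L.mus
  let TT := gridTab (n - w₀) w₀ ((gridX (n - w₀)).map tX) ((gridY w₀).map tY) L.mus
  decide (w₀ ≤ n) && signsOK (baseRows n k d e) L.base && splitSignsOK path L.smult &&
  ((List.range (n + 1)).all fun j =>
    decide (coefAG n k d e path L j ≤ 0) && decide (coefBG n k d e path L j ≤ 0) &&
      decide (coefWG n k d e path L j ≤ 0)) &&
  ((List.range (n - w₀ + 1)).all fun a => (List.range (w₀ + 1)).all fun b => (List.range (w₀ + 1)).all fun c =>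
    (!(decide (d ≤ a + b + c)) || decide (0 ≤ get3 L.kap a b c)) &&
    decide (coefRG w₀ TT path L a b c ≤ 0) && decide (coefRpG n k w₀ TP path L a b c ≤ 0)) &&
  decide (0 < leafRhsG n k d e path L)

/-- The grid certificate checker (pure, `decide`-able). Column: definition (ours). [cite: MacWilliamsSloane1977, Ch. 17 §4 Thm. 20] -/
def RTreeG.checkPath : RTreeG → List RSplit → Bool
  | .leaf L, path => rleafOKG n k d e w₀ path L
  | .split ca cb cw cr crp v le ge, path =>
    le.checkPath (path ++ [⟨ca, cb, cw, cr, crp, v, false⟩]) && ge.checkPath (path ++ [⟨ca, cb, cw, cr, crp, v, true⟩])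

/-- The grid checker for `CRSSRefinedFeasible n k d w₀` in parity branch `e`. [cite: CalderbankEtAl1998, §7 (ii)] -/
def RTreeG.check (t : RTreeG) : Bool := t.checkPath n k d e w₀ []

end Check

/-! ### 2. Soundness -/

section Soundness

variable {n k d e w₀ : ℕ} {A B W : ℕ → ℕ} {R Rp : ℕ → ℕ → ℕ → ℕ}

/-- **Weak duality for a grid leaf**: a grid leaf that checks refutes every solution of the plain + refined
system on its branch. Column: proved (ours). [cite: MacWilliamsSloane1977, Ch. 17 §4 Thm. 20] -/
theorem not_leafHyp_of_rleafOKG {path : List RSplit} {L : RLeafG} (h : rleafOKG n k d e w₀ path L = true)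
    (H : LeafHyp n k d e w₀ path A B W R Rp) : False := by
  have hsys := H.sys
  have href := H.ref
  obtain ⟨-, h0, h1, hsum, hpar, hB, hW, heq, hle, hBW, hpure⟩ := hsys
  obtain ⟨hmR, hmRp, hid, hodd, hsup, htr, hcont, hceq, hz0, hzu⟩ := href
  simp only [rleafOKG, Bool.and_eq_true, List.all_eq_true, List.mem_range, decide_eq_true_eq, Bool.or_eq_true,
    Bool.not_eq_true', decide_eq_false_iff_not] at h
  set TP := gridTab (n - w₀) w₀ (gridX (n - w₀)) (gridY w₀) L.mus with hTP
  set TT := gridTab (n - w₀) w₀ ((gridX (n - w₀)).map tX) ((gridY w₀).map tY) L.mus with hTT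
  obtain ⟨⟨⟨⟨⟨hwn, hsig⟩, hssig⟩, hABW⟩, hRRp⟩, hrhs⟩ := h
  -- (1) the base rows: `combRhs ≤ Σ_j (combA A + combB B + combW W)`
  have hbase := combRhs_le (n := n) (A := A) (B := B) (W := W) (baseRows n k d e) L.base hsig
    (sat_baseRows (n := n) h0 h1 hsum hpar hB hW heq hle hBW hpure)
  -- (2) the split rows
  have hspl := splitRhs_le (n := n) (w₀ := w₀) (A := A) (B := B) (W := W) (R := R) (Rp := Rp) path L.smult hssig H.path
  -- (3) marginal rows: `Σ_j λ_j (Σ_tri R − A_j) = 0`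
  have hmarg : ∀ (lam : List ℤ) (X : ℕ → ℕ → ℕ → ℕ) (T : ℕ → ℕ),
      (∀ j, j ≤ n → boxSum n w₀ (fun a b c => if b + c ≤ w₀ ∧ a + b + c = j then (X a b c : ℤ) else 0) = T j) →
      boxSum n w₀ (fun a b c => (if b + c ≤ w₀ then lam.getD (a + b + c) 0 else 0) * (X a b c : ℤ)) =
        ∑ j ∈ range (n + 1), lam.getD j 0 * (T j : ℤ) := by
    intro lam X T hT
    calc boxSum n w₀ (fun a b c => (if b + c ≤ w₀ then lam.getD (a + b + c) 0 else 0) * (X a b c : ℤ))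
        = boxSum n w₀ (fun a b c => ∑ j ∈ range (n + 1),
            lam.getD j 0 * (if b + c ≤ w₀ ∧ a + b + c = j then (X a b c : ℤ) else 0)) := by
          unfold boxSum
          refine Finset.sum_congr rfl fun a ha => Finset.sum_congr rfl fun b _ => Finset.sum_congr rfl fun c _ => ?_
          beta_reduce
          by_cases htri : b + c ≤ w₀
          · have hwt : a + b + c ∈ range (n + 1) := mem_range.2 (by have := mem_range.1 ha; omega)
            simp only [htri, ↓reduceIte, true_and, mul_ite, mul_zero]
            rw [Finset.sum_ite_eq, if_pos hwt]
          · simp [htri]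
      _ = ∑ j ∈ range (n + 1), lam.getD j 0 *
            boxSum n w₀ (fun a b c => if b + c ≤ w₀ ∧ a + b + c = j then (X a b c : ℤ) else 0) := by
          rw [boxSum_finset_sum]
          exact Finset.sum_congr rfl fun j _ => boxSum_mul n w₀ _ _
      _ = ∑ j ∈ range (n + 1), lam.getD j 0 * (T j : ℤ) :=
          Finset.sum_congr rfl fun j hj => by rw [hT j (Nat.lt_succ_iff.1 (mem_range.1 hj))]
  have hmargR := hmarg L.lamR R A (fun j hj => margR_tri H.ref hj)
  have hmargRp := hmarg L.lamRp Rp B (fun j hj => margRp_tri H.ref hj)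
  -- (4) evaluation points
  have hpts : boxSum n w₀ (fun a b c =>
      (if b + c ≤ w₀ then (2 : ℤ) ^ (n - k) * get3 TP a b c else 0) * Rp a b c +
      (if b + c ≤ w₀ then -get3 TT a b c else 0) * R a b c) = 0 :=
    grid_identity H.ref L.mus
  -- (5) zero rows
  have hzero : boxSum n w₀ (fun a b c => (if Odd c ∨ w₀ < b + c then get3 L.zR a b c else 0) * (R a b c : ℤ) +
      (if Odd c ∨ w₀ < b + c then get3 L.zRp a b c else 0) * (Rp a b c : ℤ)) = 0 := by
    unfold boxSum
    refine Finset.sum_eq_zero fun a _ => Finset.sum_eq_zero fun b _ => Finset.sum_eq_zero fun c _ => ?_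
    beta_reduce
    by_cases hc : Odd c ∨ w₀ < b + c
    · have hR0 : R a b c = 0 := by
        rcases hc with hc | hc
        · exact (hodd a b c hc).1
        · exact (hsup a b c (Or.inr hc)).1
      have hRp0 : Rp a b c = 0 := by
        rcases hc with hc | hc
        · exact (hodd a b c hc).2
        · exact (hsup a b c (Or.inr hc)).2
      rw [hR0, hRp0]; simp
    · simp [hc]
  -- (6) translation rows
  have htrans : boxSum n w₀ (fun a b c =>
      (if b + c ≤ w₀ then get3 L.tR a b c - get3 L.tR a (w₀ - b - c) c else 0) * (R a b c : ℤ) +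
      (if b + c ≤ w₀ then get3 L.tRp a b c - get3 L.tRp a (w₀ - b - c) c else 0) * (Rp a b c : ℤ)) = 0 := by
    have e1 : boxSum n w₀ (fun a b c => if b + c ≤ w₀ then get3 L.tR a b c * (R a (w₀ - b - c) c : ℤ) else 0) =
        boxSum n w₀ (fun a b c => if b + c ≤ w₀ then get3 L.tR a (w₀ - b - c) c * (R a b c : ℤ) else 0) :=
      boxSum_translate n w₀ (fun a b c => get3 L.tR a b c) (fun a b c => (R a b c : ℤ))
    have e2 : boxSum n w₀ (fun a b c => if b + c ≤ w₀ then get3 L.tRp a b c * (Rp a (w₀ - b - c) c : ℤ) else 0) =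
        boxSum n w₀ (fun a b c => if b + c ≤ w₀ then get3 L.tRp a (w₀ - b - c) c * (Rp a b c : ℤ) else 0) :=
      boxSum_translate n w₀ (fun a b c => get3 L.tRp a b c) (fun a b c => (Rp a b c : ℤ))
    -- the translation clause turns `R a (w₀-b-c) c` into `R a b c`
    have e1' : boxSum n w₀ (fun a b c => if b + c ≤ w₀ then get3 L.tR a b c * (R a (w₀ - b - c) c : ℤ) else 0) =
        boxSum n w₀ (fun a b c => if b + c ≤ w₀ then get3 L.tR a b c * (R a b c : ℤ) else 0) := by
      unfold boxSum
      refine Finset.sum_congr rfl fun a _ => Finset.sum_congr rfl fun b _ => Finset.sum_congr rfl fun c _ => ?_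
      beta_reduce
      split_ifs with hbc
      · rw [← (htr a b c hbc).1]
      · rfl
    have e2' : boxSum n w₀ (fun a b c => if b + c ≤ w₀ then get3 L.tRp a b c * (Rp a (w₀ - b - c) c : ℤ) else 0) =
        boxSum n w₀ (fun a b c => if b + c ≤ w₀ then get3 L.tRp a b c * (Rp a b c : ℤ) else 0) := by
      unfold boxSum
      refine Finset.sum_congr rfl fun a _ => Finset.sum_congr rfl fun b _ => Finset.sum_congr rfl fun c _ => ?_
      beta_reduce
      split_ifs with hbc
      · rw [← (htr a b c hbc).2]
      · rfl
    have key : boxSum n w₀ (fun a b c =>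
        (if b + c ≤ w₀ then get3 L.tR a b c - get3 L.tR a (w₀ - b - c) c else 0) * (R a b c : ℤ) +
        (if b + c ≤ w₀ then get3 L.tRp a b c - get3 L.tRp a (w₀ - b - c) c else 0) * (Rp a b c : ℤ)) =
        (boxSum n w₀ (fun a b c => if b + c ≤ w₀ then get3 L.tR a b c * (R a b c : ℤ) else 0) -
          boxSum n w₀ (fun a b c => if b + c ≤ w₀ then get3 L.tR a (w₀ - b - c) c * (R a b c : ℤ) else 0)) +
        (boxSum n w₀ (fun a b c => if b + c ≤ w₀ then get3 L.tRp a b c * (Rp a b c : ℤ) else 0) -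
          boxSum n w₀ (fun a b c => if b + c ≤ w₀ then get3 L.tRp a (w₀ - b - c) c * (Rp a b c : ℤ) else 0)) := by
      unfold boxSum
      simp only [← Finset.sum_sub_distrib, ← Finset.sum_add_distrib]
      refine Finset.sum_congr rfl fun a _ => Finset.sum_congr rfl fun b _ => Finset.sum_congr rfl fun c _ => ?_
      split_ifs <;> ring
    rw [key, ← e1, e1', ← e2, e2', sub_self, sub_self, add_zero]
  -- (7) containment rows
  have hcontain : 0 ≤ boxSum n w₀ (fun a b c => get3 L.kap a b c * ((Rp a b c : ℤ) - R a b c)) := by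
    unfold boxSum
    refine Finset.sum_nonneg fun a ha => Finset.sum_nonneg fun b hb => Finset.sum_nonneg fun c hc => ?_
    beta_reduce
    by_cases hwt : d ≤ a + b + c
    · have hk : 0 ≤ get3 L.kap a b c := by
        rcases hRRp a (mem_range.1 ha) b (mem_range.1 hb) c (mem_range.1 hc) with ⟨⟨hk, -⟩, -⟩
        rcases hk with hk | hk
        · exact absurd hwt hk
        · exact hk
      have hge : (R a b c : ℤ) ≤ Rp a b c := by exact_mod_cast hcont a b c
      nlinarith
    · rw [hceq a b c (by omega), sub_self, mul_zero]
  -- (8) the two unit rows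
  have hunit : L.zeta * ((R 0 0 0 : ℤ) - 1) + L.ups * ((R 0 w₀ 0 : ℤ) - 1) = 0 := by
    rw [hz0, hzu]; simp
  -- (9) nonpositivity of the coefficient sums
  have hnegABW : ∑ j ∈ range (n + 1), (coefAG n k d e path L j * (A j : ℤ) + coefBG n k d e path L j * (B j : ℤ) +
      coefWG n k d e path L j * (W j : ℤ)) ≤ 0 := by
    refine Finset.sum_nonpos fun j hj => ?_
    obtain ⟨⟨ha, hb⟩, hw⟩ := hABW j (mem_range.1 hj)
    have hA : (0 : ℤ) ≤ A j := Nat.cast_nonneg _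
    have hB' : (0 : ℤ) ≤ B j := Nat.cast_nonneg _
    have hW' : (0 : ℤ) ≤ W j := Nat.cast_nonneg _
    nlinarith
  have hnegR : boxSum n w₀ (fun a b c => coefRG w₀ TT path L a b c * (R a b c : ℤ) +
      coefRpG n k w₀ TP path L a b c * (Rp a b c : ℤ)) ≤ 0 := by
    refine boxSum_nonpos fun a ha b hb c hc => ?_
    obtain ⟨⟨-, hr⟩, hrp⟩ := hRRp a (mem_range.1 ha) b (mem_range.1 hb) c (mem_range.1 hc)
    have h1 : (0 : ℤ) ≤ R a b c := Nat.cast_nonneg _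
    have h2 : (0 : ℤ) ≤ Rp a b c := Nat.cast_nonneg _
    nlinarith
  -- (10) the grand identity: expand the coefficient sums into the row contributions
  have hexpABW : ∑ j ∈ range (n + 1), (coefAG n k d e path L j * (A j : ℤ) + coefBG n k d e path L j * (B j : ℤ) +
      coefWG n k d e path L j * (W j : ℤ)) =
      ∑ j ∈ range (n + 1), (combA (baseRows n k d e) L.base j * (A j : ℤ) + combB (baseRows n k d e) L.base j * B j +
        combW (baseRows n k d e) L.base j * W j) -
      ∑ j ∈ range (n + 1), L.lamR.getD j 0 * (A j : ℤ) - ∑ j ∈ range (n + 1), L.lamRp.getD j 0 * (B j : ℤ) +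
      ∑ j ∈ range (n + 1), (splitCoef path L.smult (fun s => s.ca.getD j 0) * A j +
        splitCoef path L.smult (fun s => s.cb.getD j 0) * B j + splitCoef path L.smult (fun s => s.cw.getD j 0) * W j) := by
    simp only [coefAG, coefBG, coefWG, ← Finset.sum_sub_distrib, ← Finset.sum_add_distrib]
    refine Finset.sum_congr rfl fun j _ => ?_
    ring
  have hexpR : boxSum n w₀ (fun a b c => coefRG w₀ TT path L a b c * (R a b c : ℤ) +
      coefRpG n k w₀ TP path L a b c * (Rp a b c : ℤ)) =
      boxSum n w₀ (fun a b c => (if b + c ≤ w₀ then L.lamR.getD (a + b + c) 0 else 0) * (R a b c : ℤ)) +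
      boxSum n w₀ (fun a b c => (if b + c ≤ w₀ then L.lamRp.getD (a + b + c) 0 else 0) * (Rp a b c : ℤ)) +
      boxSum n w₀ (fun a b c =>
        (if b + c ≤ w₀ then (2 : ℤ) ^ (n - k) * get3 TP a b c else 0) *
            Rp a b c +
          (if b + c ≤ w₀ then -get3 TT a b c else 0) * R a b c) +
      boxSum n w₀ (fun a b c => (if Odd c ∨ w₀ < b + c then get3 L.zR a b c else 0) * (R a b c : ℤ) +
        (if Odd c ∨ w₀ < b + c then get3 L.zRp a b c else 0) * (Rp a b c : ℤ)) +
      boxSum n w₀ (fun a b c =>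
        (if b + c ≤ w₀ then get3 L.tR a b c - get3 L.tR a (w₀ - b - c) c else 0) * (R a b c : ℤ) +
        (if b + c ≤ w₀ then get3 L.tRp a b c - get3 L.tRp a (w₀ - b - c) c else 0) * (Rp a b c : ℤ)) +
      boxSum n w₀ (fun a b c => get3 L.kap a b c * ((Rp a b c : ℤ) - R a b c)) +
      boxSum n w₀ (fun a b c => (if a = 0 ∧ b = 0 ∧ c = 0 then L.zeta else 0) * (R a b c : ℤ) +
        (if a = 0 ∧ b = w₀ ∧ c = 0 then L.ups else 0) * (R a b c : ℤ)) +
      boxSum n w₀ (fun a b c => splitCoef path L.smult (fun s => get3 s.cr a b c) * R a b c +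
        splitCoef path L.smult (fun s => get3 s.crp a b c) * Rp a b c) := by
    simp only [← boxSum_add]
    unfold boxSum
    refine Finset.sum_congr rfl fun a _ => Finset.sum_congr rfl fun b _ => Finset.sum_congr rfl fun c _ => ?_
    beta_reduce
    simp only [coefRG, coefRpG]
    split_ifs <;> ring
  -- the two unit rows as box sums
  have hunitbox : boxSum n w₀ (fun a b c => (if a = 0 ∧ b = 0 ∧ c = 0 then L.zeta else 0) * (R a b c : ℤ) +
      (if a = 0 ∧ b = w₀ ∧ c = 0 then L.ups else 0) * (R a b c : ℤ)) = L.zeta * R 0 0 0 + L.ups * R 0 w₀ 0 := by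
    rw [boxSum_add, boxSum_ite_eq n w₀ 0 (Nat.zero_le _) L.zeta (fun a b c => (R a b c : ℤ)),
      boxSum_ite_eq n w₀ w₀ le_rfl L.ups (fun a b c => (R a b c : ℤ))]
  -- combine
  have hrhs' : (0 : ℤ) < leafRhsG n k d e path L := hrhs
  unfold leafRhsG at hrhs'
  linarith [hbase, hspl, hmargR, hmargRp, hpts, hzero, htrans, hcontain, hunit, hnegABW, hnegR, hexpABW, hexpR,
    hunitbox]


/-- Soundness of the grid tree checker. Column: proved (ours). [cite: MacWilliamsSloane1977, Ch. 17 §4 Thm. 20] -/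
theorem not_leafHyp_of_checkPathG (t : RTreeG) {path : List RSplit} (h : t.checkPath n k d e w₀ path = true)
    (H : LeafHyp n k d e w₀ path A B W R Rp) : False := by
  induction t generalizing path with
  | leaf L => exact not_leafHyp_of_rleafOKG h H
  | split ca cb cw cr crp v le ge ihl ihg =>
    simp only [RTreeG.checkPath, Bool.and_eq_true] at h
    rcases rsplit_holds_or n w₀ ca cb cw cr crp v A B W R Rp with hl | hg
    · refine ihl h.1 ⟨H.sys, H.ref, fun s hs => ?_⟩
      rcases List.mem_append.1 hs with hs | hs
      · exact H.path s hs
      · rw [List.mem_singleton.1 hs]; exact hl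
    · refine ihg h.2 ⟨H.sys, H.ref, fun s hs => ?_⟩
      rcases List.mem_append.1 hs with hs | hs
      · exact H.path s hs
      · rw [List.mem_singleton.1 hs]; exact hg

/-- **Two checked grid certificates (one per parity branch) refute the refined system** — UNCONDITIONAL.
Column: proved (ours). [cite: CalderbankEtAl1998, §7 (ii) (printed p. 28)] -/
theorem not_crssRefinedFeasible_of_checkG (t₀ t₁ : RTreeG) (h₀ : t₀.check n k d 0 w₀ = true)
    (h₁ : t₁.check n k d 1 w₀ = true) : ¬ CRSSRefinedFeasible n k d w₀ := by
  rintro ⟨A, B, W, e, R, Rp, hsys, href⟩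
  have he := hsys.1
  interval_cases e
  · exact not_leafHyp_of_checkPathG (path := []) t₀ h₀ ⟨hsys, href, fun s hs => by simp at hs⟩
  · exact not_leafHyp_of_checkPathG (path := []) t₁ h₁ ⟨hsys, href, fun s hs => by simp at hs⟩

end Soundness

end Summit.Ventures.QEC.Census
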